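import Mathlib.AlgebraicGeometry.Morphisms.Finite
import Mathlib.FieldTheory.IsAlgClosed.Basic
import Summits.ResolutionOfSingularities.ResolutionOfSingularities.Theorems.EquisingularLiftEquisingularLiftNatMultisection
import HarnessLib

/-!
# [OURS · L1 W4.5(b) · EL♮] T-MULTISEC inputs, 2: special closed points are `k`-rational (L-RAT)
# (crux `EquisingularLiftNat` = stmt-ResolutionOfSingularities-20038)

HONEST FRAMING. OURS (cell res-hironaka, crux chain w45b, slot W4.5(b)); NOT a statement of any manuscript; AI-written,
weaker than expert review. Helper `--supports stmt-ResolutionOfSingularities-20038 --as helper`; second input lemma of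
the ADAPTER `hMS` := T-MULTISEC ⇒ T-TAIL (res-D-pv-013 2026-08-27T07:37:46Z), discharging the hypothesis `hres` of
`exists_multisection` («`O → κ(b)` is onto»).

* `comap_maximalIdeal_stalkHom_eq` — the structure map `φ_b : O → 𝒪_{P,b}` pulls `𝔪_b` back to the prime `r b`.
* `isLocalHom_stalkHom` — over the closed point of a local base, `φ_b` is a local homomorphism.
* `residue_comp_stalkHom_surjective` (L-RAT) — `O` local with ALGEBRAICALLY CLOSED residue field `k`, `r : P → Spec O`
  locally of finite type, `b ∈ P` a CLOSED point over the closed point: `O → κ(b)` is onto. Proof: `φ_b` is local, so it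
  induces `ψ : k → κ(b)`; `Spec κ(b) → Spec k → Spec O` is `Spec κ(b) ↪ P → Spec O` (a closed immersion followed by a
  morphism locally of finite type), so `Spec ψ` is locally of finite type, hence finite (`Spec k` is Jacobson — Hilbert's
  Nullstellensatz, Mathlib `isFinite_iff_locallyOfFiniteType_of_jacobsonSpace`), so `ψ` is integral and therefore
  bijective (`IsAlgClosed.ringHom_bijective_of_isIntegral`).

References: Hilbert's Nullstellensatz (Q. Liu, *Algebraic Geometry and Arithmetic Curves*, Cor. 2.1.12, Prop. 3.2.16) —
through Mathlib.
-/

set_option linter.dupNamespace false -- mandated namespace `Summit.<Summit>.<Problem>` of this single-conjunct summit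

open CategoryTheory AlgebraicGeometry TopologicalSpace Topology IsLocalRing
open AlgebraicGeometry.Scheme.IdealSheafData Literature.AlgebraicGeometry.Resolution

namespace Summit.ResolutionOfSingularities.ResolutionOfSingularities.Cruxes.EquisingularLiftNat.Sections

/-! ## The structure map `O → 𝒪_{P,b}` is local over the closed point -/

/-- The structure map `φ_b : O → 𝒪_{P,b}` pulls the maximal ideal `𝔪_b` back to the prime ideal of the image point
`r b ∈ Spec O` (`Spec 𝒪_{P,b} → P → Spec O` is `Spec φ_b` and sends the closed point to `r b`). [folklore] -/
theorem comap_maximalIdeal_stalkHom_eq {O : Type} [CommRing O] {P : Scheme.{0}} (r : P ⟶ Spec (.of O)) (b : P) :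
    (maximalIdeal (P.presheaf.stalk b)).comap ((Scheme.ΓSpecIso (.of O)).inv ≫
      (Spec (.of O)).presheaf.germ ⊤ (r b) trivial ≫ r.stalkMap b).hom = (r b).asIdeal := by
  have h := apply_fromSpecStalk_eq r b (maximalIdeal (P.presheaf.stalk b))
  have h2 : P.fromSpecStalk b ⟨maximalIdeal _, inferInstance⟩ = b := Scheme.fromSpecStalk_closedPoint
  rw [h2] at h
  exact (congrArg PrimeSpectrum.asIdeal h).symm

/-- Over the closed point of a local base ring `O` (`r b = s₀`), the structure map `φ_b : O → 𝒪_{P,b}` is a LOCAL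
homomorphism. [folklore] -/
theorem isLocalHom_stalkHom {O : Type} [CommRing O] [IsLocalRing O] {P : Scheme.{0}} (r : P ⟶ Spec (.of O)) {b : P}
    (hb : r b = closedPoint O) :
    IsLocalHom ((Scheme.ΓSpecIso (.of O)).inv ≫ (Spec (.of O)).presheaf.germ ⊤ (r b) trivial ≫ r.stalkMap b).hom := by
  have hcomap := comap_maximalIdeal_stalkHom_eq r b
  have hrb : (r b).asIdeal = maximalIdeal O := by rw [hb]; rfl
  refine ⟨fun a ha => ?_⟩
  by_contra hna
  have hmem : a ∈ maximalIdeal O := (mem_maximalIdeal _).mpr hna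
  have hmem' : a ∈ (r b).asIdeal := by rw [hrb]; exact hmem
  rw [← hcomap, Ideal.mem_comap] at hmem'
  exact (mem_maximalIdeal _).mp hmem' ha

/-! ## L-RAT: closed points of the special fibre are `k`-rational -/

/-- **L-RAT (closed special points are `k`-rational).** Let `O` be a local ring with ALGEBRAICALLY CLOSED residue field
`k`, `r : P → Spec O` locally of finite type and `b ∈ P` a CLOSED point over the closed point of `Spec O`. Then the
composite `O → 𝒪_{P,b} → κ(b)` is onto (so `κ(b) = k`). Proof: the induced `ψ : k → κ(b)` has `Spec ψ` locally of finite
type (`Spec κ(b) ↪ P → Spec O` factors through it), hence finite since `Spec k` is Jacobson (Nullstellensatz), hence `ψ`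
is integral and — `k` being algebraically closed — bijective. [folklore] -/
theorem residue_comp_stalkHom_surjective {O : Type} [CommRing O] [IsLocalRing O] [IsAlgClosed (ResidueField O)]
    {P : Scheme.{0}} (r : P ⟶ Spec (.of O)) [LocallyOfFiniteType r] {b : P} (hbc : IsClosed ({b} : Set P))
    (hb : r b = closedPoint O) :
    Function.Surjective ((residue (P.presheaf.stalk b)).comp ((Scheme.ΓSpecIso (.of O)).inv ≫
      (Spec (.of O)).presheaf.germ ⊤ (r b) trivial ≫ r.stalkMap b).hom) := by
  haveI hloc := isLocalHom_stalkHom r hb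
  have hc := fromSpecStalk_comp_eq r b
  set φ := (Scheme.ΓSpecIso (.of O)).inv ≫ (Spec (.of O)).presheaf.germ ⊤ (r b) trivial ≫ r.stalkMap b with hφ
  -- the induced homomorphism of residue fields `ψ : k → κ(b)`
  set ψ : ResidueField O →+* ResidueField (P.presheaf.stalk b) := ResidueField.map φ.hom with hψ
  have hfact : (residue (P.presheaf.stalk b)).comp φ.hom = ψ.comp (residue O) :=
    (ResidueField.map_comp_residue φ.hom).symm
  rw [hfact, RingHom.coe_comp]
  refine Function.Surjective.comp ?_ residue_surjective
  -- `Spec κ(b) → Spec k → Spec O` is `Spec κ(b) ↪ P → Spec O`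
  set ψ' : CommRingCat.of (ResidueField O) ⟶ P.residueField b := CommRingCat.ofHom ψ with hψ'
  have hring : CommRingCat.ofHom (residue O) ≫ ψ' = φ ≫ P.residue b := by
    apply CommRingCat.hom_ext
    rw [CommRingCat.hom_comp, CommRingCat.hom_comp]
    exact hfact.symm
  have hcomp : Spec.map ψ' ≫ Spec.map (CommRingCat.ofHom (residue O)) = P.fromSpecResidueField b ≫ r := by
    rw [← Spec.map_comp, hring, Spec.map_comp, ← hc, Scheme.fromSpecResidueField, Category.assoc]
  haveI : IsClosedImmersion (P.fromSpecResidueField b) := isClosed_singleton_iff_isClosedImmersion.mp hbc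
  haveI : LocallyOfFiniteType (Spec.map ψ' ≫ Spec.map (CommRingCat.ofHom (residue O))) := by
    rw [hcomp]; infer_instance
  haveI : LocallyOfFiniteType (Spec.map ψ') :=
    locallyOfFiniteType_of_comp _ (Spec.map (CommRingCat.ofHom (residue O)))
  -- `Spec k` is Jacobson: `Spec ψ` is finite, so `ψ` is integral, so bijective
  haveI : IsFinite (Spec.map ψ') := isFinite_iff_locallyOfFiniteType_of_jacobsonSpace.mpr inferInstance
  have hint : ψ.IsIntegral := IsIntegralHom.SpecMap_iff.mp (inferInstance : IsIntegralHom (Spec.map ψ'))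
  exact (IsAlgClosed.ringHom_bijective_of_isIntegral ψ hint).2

end Summit.ResolutionOfSingularities.ResolutionOfSingularities.Cruxes.EquisingularLiftNat.Sections
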